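import Summits.AtomisticToContinuum.HydrodynamicLimit.Theorems.RelayRaceLocalityNearConstantShortTimeHLExpTailDefs
import HarnessLib

/-!
# Crux `NearConstantShortTimeHL` (stmt-AtomisticToContinuum-12502), line `small-tilt-domination` — the true-law caps input S4‴ `TrueLawCapsPE` SPLIT INTO ITS
# TWO CONJUNCTS: `TrueLawPackingCap` (ball-packing cap) and `TrueLawExpMoments` (all exponential velocity moments in mean) (typed statements, lead c10)

Reviewed Defs file of the line (lead prover-line-stmt-AtomisticToContinuum-12502-c10-0). WHY: the residue of the line (v25 / HL project) is
`{TrueLawMomentumClosure, TrueLawEnergyClosure, TrueLawCapsPE}` (`…EndgameTL`, `…EndgameHL`); `TrueLawCapsPE` (`…ExpTailDefs`) is a conjunction of two a-priori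
inputs along the true law with DIFFERENT provenance and attack surface — (b) the ball-packing cap at radius `n^{-1/4}` (general-family twin of `NoDenseInclusions`,
stmt-14425: an exclusion of dense mesoscopic inclusions, static-LD flavoured) and (c″) all exponential velocity moments in mean at fixed times (the
`HighMomentumCutoffNarrow` minimal form: propagation of velocity tails, kinetic flavoured, NOT controlled by the `O(n)` entropy bound). For the planner to file
them as separate items, this file types the two conjuncts behind the common prefix of `TrueLawCapsPE` and proves the recombination
`trueLawCapsPE_of_split : TrueLawPackingCap → TrueLawExpMoments → TrueLawCapsPE` (take `σ₀ := min σ₀ᵇ σ₀ᶜ`) and the two projections. No new mathematics.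
References: B. Nachtergaele – H.-T. Yau, Comm. Math. Phys. 243 (2003) §3.2; H.-T. Yau, Lett. Math. Phys. 22 (1991) §2.
-/

noncomputable section

namespace Summit.AtomisticToContinuum.HydrodynamicLimit.Theorems.NearConstantShortTimeHL

open scoped BigOperators ENNReal
open MeasureTheory Set Filter Topology
open Literature.MathematicalPhysics.KineticTheory Literature.Analysis.FluidPDE Literature.Analysis.FunctionSpaces

/-- **S4ᵇ — THE BALL-PACKING CAP ALONG THE TRUE LAW, general families** (conjunct (b) of `TrueLawCapsPE` behind its prefix): pre-shock, inside the packing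
band `ρσ³ ≤ η₁/2`, the probability that some ball of radius `n^{-1/4}` carries packing `> η₁` at some `r ≤ t` tends to `0` (general-family twin of
`NoDenseInclusions`, stmt-14425). OPEN. [cite: Yau1991, §2] -/
@[conjecture] def TrueLawPackingCap : Prop :=
  ∀ η₁ : ℝ, 0 < η₁ → ∀ (a₀ θ₀ : T3 → ℝ) (u₀ : T3 → V3), Continuous a₀ → Continuous θ₀ → Continuous u₀ →
    (∀ x, 0 < a₀ x) → (∀ x, 0 < θ₀ x) → ∃ σ₀ : ℝ, 0 < σ₀ ∧ ∀ σ : ℝ, 0 < σ → σ < σ₀ →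
    ∀ (ε : ℕ → ℝ) (n : ℕ → ℕ), (∀ N, 0 < ε N) → Tendsto ε atTop (nhds 0) →
    Tendsto (fun N => (n N : ℝ) * ε N ^ 3) atTop (nhds (σ ^ 3)) →
    ∀ (T : ℝ) (ρ θ : ℝ → T3 → ℝ) (u : ℝ → T3 → V3), IsHardSphereEulerSolution σ T ρ u θ →
    ∀ Φ : (N : ℕ) → HardSphereFlow (Torus.geometry (Fin 3)) (ε N) (n N),
    let P : (N : ℕ) → Measure (Config (n N) (Fin 3) T3) := fun N =>
      particleLaw (Φ N) (canonicalDensity (Torus.geometry (Fin 3)) (ε N) (n N) (localGibbsProfile a₀ u₀ θ₀));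
    (∀ N, IsProbabilityMeasure (P N)) →
    (∀ χ : T3 → ℝ, Continuous χ → ∀ δ : ℝ, 0 < δ →
      Tendsto (fun N => P N {z | δ < |empiricalDensityField ((Φ N).flow 0 z) χ - ∫ x, χ x * ρ 0 x|}) atTop (nhds 0) ∧
      Tendsto (fun N => P N {z | δ < ‖empiricalMomentumField ((Φ N).flow 0 z) χ - ∫ x, (χ x * ρ 0 x) • u 0 x‖}) atTop (nhds 0) ∧
      Tendsto (fun N => P N {z | δ < |empiricalEnergyField ((Φ N).flow 0 z) χ -
        ∫ x, χ x * totalEnergyDensity (ρ 0 x) (u 0 x) (θ 0 x)|}) atTop (nhds 0)) →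
    ∀ t ∈ Set.Ico 0 T, (∀ s ∈ Set.Icc 0 t, ∀ x, ρ s x * σ ^ 3 ≤ η₁ / 2) →
      Tendsto (fun N => P N {z | ∃ r ∈ Set.Icc 0 t, ∃ x : T3,
        η₁ < empiricalDensityField ((Φ N).flow r z)
          (fun y => if Torus.euclidDist x y < (n N : ℝ) ^ (-(1 / 4 : ℝ))
            then (4 / 3 * Real.pi * ((n N : ℝ) ^ (-(1 / 4 : ℝ))) ^ 3)⁻¹ else 0) * σ ^ 3}) atTop (nhds 0)

/-- **S4ᶜ — ALL EXPONENTIAL VELOCITY MOMENTS IN MEAN ALONG THE TRUE LAW, general families** (conjunct (c″) of `TrueLawCapsPE` behind its prefix): for every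
`b > 0` some `A`, eventually in `N`, `E_{P_N}[n⁻¹Σᵢ exp(b‖vᵢ(s)‖)] ≤ A` for all `s ≤ t` (the `HighMomentumCutoffNarrow` minimal form; true at `t = 0`). OPEN.
[cite: NachtergaeleYau2003, §3.2] -/
@[conjecture] def TrueLawExpMoments : Prop :=
  ∀ η₁ : ℝ, 0 < η₁ → ∀ (a₀ θ₀ : T3 → ℝ) (u₀ : T3 → V3), Continuous a₀ → Continuous θ₀ → Continuous u₀ →
    (∀ x, 0 < a₀ x) → (∀ x, 0 < θ₀ x) → ∃ σ₀ : ℝ, 0 < σ₀ ∧ ∀ σ : ℝ, 0 < σ → σ < σ₀ →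
    ∀ (ε : ℕ → ℝ) (n : ℕ → ℕ), (∀ N, 0 < ε N) → Tendsto ε atTop (nhds 0) →
    Tendsto (fun N => (n N : ℝ) * ε N ^ 3) atTop (nhds (σ ^ 3)) →
    ∀ (T : ℝ) (ρ θ : ℝ → T3 → ℝ) (u : ℝ → T3 → V3), IsHardSphereEulerSolution σ T ρ u θ →
    ∀ Φ : (N : ℕ) → HardSphereFlow (Torus.geometry (Fin 3)) (ε N) (n N),
    let P : (N : ℕ) → Measure (Config (n N) (Fin 3) T3) := fun N =>
      particleLaw (Φ N) (canonicalDensity (Torus.geometry (Fin 3)) (ε N) (n N) (localGibbsProfile a₀ u₀ θ₀));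
    (∀ N, IsProbabilityMeasure (P N)) →
    (∀ χ : T3 → ℝ, Continuous χ → ∀ δ : ℝ, 0 < δ →
      Tendsto (fun N => P N {z | δ < |empiricalDensityField ((Φ N).flow 0 z) χ - ∫ x, χ x * ρ 0 x|}) atTop (nhds 0) ∧
      Tendsto (fun N => P N {z | δ < ‖empiricalMomentumField ((Φ N).flow 0 z) χ - ∫ x, (χ x * ρ 0 x) • u 0 x‖}) atTop (nhds 0) ∧
      Tendsto (fun N => P N {z | δ < |empiricalEnergyField ((Φ N).flow 0 z) χ -
        ∫ x, χ x * totalEnergyDensity (ρ 0 x) (u 0 x) (θ 0 x)|}) atTop (nhds 0)) →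
    ∀ t ∈ Set.Ico 0 T, (∀ s ∈ Set.Icc 0 t, ∀ x, ρ s x * σ ^ 3 ≤ η₁ / 2) →
      ∀ b : ℝ, 0 < b → ∃ A : ℝ, ∀ᶠ N : ℕ in atTop, ∀ s ∈ Set.Icc 0 t,
        ∫⁻ z, ENNReal.ofReal ((n N : ℝ)⁻¹ * ∑ i : Fin (n N), Real.exp (b * ‖((Φ N).flow s z i).2‖)) ∂(P N) ≤
          ENNReal.ofReal A


/-! ## Recombination and projections -/

/-- **`TrueLawPackingCap → TrueLawExpMoments → TrueLawCapsPE`** (take the smaller of the two `σ₀`'s). [folklore] -/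
theorem trueLawCapsPE_of_split : TrueLawPackingCap → TrueLawExpMoments → TrueLawCapsPE := by
  intro HB HC η₁ hη₁ a₀ θ₀ u₀ ha hθ hu ha0 hθ0
  obtain ⟨σb, hσb, HB'⟩ := HB η₁ hη₁ a₀ θ₀ u₀ ha hθ hu ha0 hθ0
  obtain ⟨σc, hσc, HC'⟩ := HC η₁ hη₁ a₀ θ₀ u₀ ha hθ hu ha0 hθ0
  refine ⟨min σb σc, lt_min hσb hσc, fun σ hσ hσ' ε n hε hε0 hn T ρ θ u hE Φ => ?_⟩
  have hB := HB' σ hσ (hσ'.trans_le (min_le_left _ _)) ε n hε hε0 hn T ρ θ u hE Φ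
  have hC := HC' σ hσ (hσ'.trans_le (min_le_right _ _)) ε n hε hε0 hn T ρ θ u hE Φ
  dsimp only at hB hC ⊢
  intro hP h0 t ht hband
  exact ⟨hB hP h0 t ht hband, hC hP h0 t ht hband⟩

/-- **`TrueLawCapsPE → TrueLawPackingCap`** (first projection). [folklore] -/
theorem trueLawPackingCap_of_PE : TrueLawCapsPE → TrueLawPackingCap := by
  intro H η₁ hη₁ a₀ θ₀ u₀ ha hθ hu ha0 hθ0
  obtain ⟨σ₀, hσ₀, H'⟩ := H η₁ hη₁ a₀ θ₀ u₀ ha hθ hu ha0 hθ0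
  refine ⟨σ₀, hσ₀, fun σ hσ hσ' ε n hε hε0 hn T ρ θ u hE Φ => ?_⟩
  have h := H' σ hσ hσ' ε n hε hε0 hn T ρ θ u hE Φ
  dsimp only at h ⊢
  intro hP h0 t ht hband
  exact (h hP h0 t ht hband).1

/-- **`TrueLawCapsPE → TrueLawExpMoments`** (second projection). [folklore] -/
theorem trueLawExpMoments_of_PE : TrueLawCapsPE → TrueLawExpMoments := by
  intro H η₁ hη₁ a₀ θ₀ u₀ ha hθ hu ha0 hθ0
  obtain ⟨σ₀, hσ₀, H'⟩ := H η₁ hη₁ a₀ θ₀ u₀ ha hθ hu ha0 hθ0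
  refine ⟨σ₀, hσ₀, fun σ hσ hσ' ε n hε hε0 hn T ρ θ u hE Φ => ?_⟩
  have h := H' σ hσ hσ' ε n hε hε0 hn T ρ θ u hE Φ
  dsimp only at h ⊢
  intro hP h0 t ht hband
  exact (h hP h0 t ht hband).2

end Summit.AtomisticToContinuum.HydrodynamicLimit.Theorems.NearConstantShortTimeHL

end
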